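import Mathlib
import Literature.Computability.Cryptography.ClassBQP
import Literature.Computability.Complexity.Classes
import HarnessLib

/-!
# The one-clean-qubit model `DQC1` (Knill–Laflamme 1998) and `DQC1 ⊆ BQP` — definition + named fact

Topic `Literature/Computability/QuantumComplexity`. ONE DEFINITION (the decidability predicate of
the one-clean-qubit model in Shor–Jordan's decision form, over the tree's Clifford+T circuits
`Literature.Computability.Cryptography.QCircuit cliffordT`, `probEvent`, `acceptEvent`, `FP`) and
ONE NAMED FACT (D-0014, statement only, `def … : Prop`): every language so decided is in the tree's
`BQP`. Requested by the grounding of route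
`Summit.QuantumAdvantage.QuantumAdvantage.Theses.SeparableFrames`: its support item
`OneCleanQubitInBQP` (stmt-QuantumAdvantage-9865, "THE BRIDGE … a theorem; XL to formalise") is
`∀ L, IsDQC1Decidable L → L ∈ BQP` by `Iff.rfl`, and its target `OneCleanQubitHard`
(stmt-QuantumAdvantage-9861) reads `∃ L, IsDQC1Decidable L ∧ L ∉ BPP`.

## What is printed

* E. Knill, R. Laflamme, *Power of one bit of quantum information*, Phys. Rev. Lett. **81** (1998)
  5672–5675 [KnillLaflamme1998] (held: arXiv:quant-ph/9802037, read pp. 4–6): "Deterministic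
  quantum computation with one qubit (DQC1): The deviation of the initial state of the quantum
  system is `σ_z^{(1)}`. The final answer is obtained as in DQCp by a bounded variance process
  yielding `⟨σ_z^{(1)}⟩`. The initial state corresponds to having one bit in a pure state and the
  rest completely random." Conclusion: "We have introduced a new model of computation (DQC1) with
  power between classical computation and deterministic quantum computation with pure states
  (DQCp)."
* P. W. Shor, S. P. Jordan, *Estimating Jones polynomials is a complete problem for one clean
  qubit*, Quantum Inf. Comput. **8** (2008) 681–714 [ShorJordan2008] (held: arXiv:0707.2831, read
  §1): initial state `ρ = |0⟩⟨0| ⊗ I/2ⁿ`, "apply any polynomial-size quantum circuit to `ρ`, and then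
  measure the first qubit", `p₀ = 2^{−n} tr[(|0⟩⟨0|⊗I) U (|0⟩⟨0|⊗I) U†]`; "The one clean qubit
  complexity class consists of the decision problems which can be solved in polynomial time by a
  one clean qubit machine with correctness probability of at least 2/3"; bias `1/2 ± ε` with `ε`
  inverse-polynomial suffices by repetition; "In the original definition [Knill] of DQC1 it is
  assumed that a classical computer generates the quantum circuits to be applied to the initial
  state `ρ`"; and (same §) measuring mid-computation would make "all the qubits 'clean' … re-obtaining
  BQP", "one clean qubit computers … being strictly weaker than standard quantum computers" — the
  containment `DQC1 ⊆ BQP` (purify the maximally mixed register, e.g. as halves of Bell pairs, run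
  the same circuit, measure the clean wire; amplify by majority) is the folklore half of that
  comparison and is what the fact below records.

## Rendering

The route's decision form is kept VERBATIM (so that the items unfold to the names here by `rfl`):
for each input `x` a classical poly-time procedure outputs (the `sigmaEncode` description of) an
oracle-free Clifford+T circuit `C x` on `1 + k x` wires — `x ↦ ⟨1, k x, C x⟩ ∈ FP`, the ancilla
count `k x` written in unary inside `sigmaEncode`, hence polynomial size; the clean wire `0` is
prepared in `|0⟩`, the register wires `1 … k x` are maximally mixed, i.e. the acceptance
probability is the uniform AVERAGE over basis inputs `r ∈ QReg (k x)` of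
`probEvent 0 (basisState (0 :: r)) (acceptEvent (1 + k x))` (measure wire `0`); two-sided bias
`1/(q(|x|)+1)` around `1/2` for a polynomial `q`. This is Shor–Jordan's model with two
inessential specialisations, both of which only SHRINK the class (so `⊆ BQP` remains exactly as
printed): the gate set is the tree's Clifford+T (`cliffordT`, universal; Shor–Jordan allow any
polynomial-size circuit) and no intermediate classical adaptivity is used. `BQP` is the tree's
`Literature.Computability.Cryptography.BQP` (`BQPOver cliffordT`, error `1/3`, uniform families).

## Tree search

`lean search 'DQC1|clean qubit|OneCleanQubit'`: nothing in Mathlib/Literature (the phrase occurs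
only in route docstrings of QuantumAdvantage Theses files). `BQP`, `QCircuit`, `probEvent`,
`acceptEvent`, `sigmaEncode`, `FP` are the tree's (ClassBQP.lean, QuantumCircuit.lean,
Complexity/Classes.lean).

## References

* [KnillLaflamme1998] Phys. Rev. Lett. 81 (1998) 5672, definition of DQC1 (p. 5673) and the
  concluding comparison (p. 5675). arXiv:quant-ph/9802037.
* [ShorJordan2008] QIC 8 (2008) 681, §1 "One clean qubit" (pp. 682–684 of the arXiv version).
-/

noncomputable section

namespace Literature.Computability.QuantumComplexity

open Literature.Computability.Cryptography Literature.Computability.Complexity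

/-- **`L` is decided in the one-clean-qubit model `DQC1`** (Knill–Laflamme 1998; decision form of
Shor–Jordan 2008 §1), over Clifford+T: there are a register size `k x`, oracle-free circuits `C x`
on `1 + k x` wires whose descriptions `x ↦ ⟨1, k x, C x⟩` are `FP`-computable, and a polynomial
`q`, such that the acceptance probability with wire `0` clean (`|0⟩`) and wires `1 … k x`
maximally mixed (uniform average over basis inputs `r`) is `≥ 1/2 + 1/(q(|x|)+1)` for `x ∈ L` and
`≤ 1/2 − 1/(q(|x|)+1)` for `x ∉ L`. Verbatim the hypothesis of route items
`…SeparableFrames.OneCleanQubitInBQP` / `…OneCleanQubitHard`.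
[cite: ShorJordan2008, §1 (the one clean qubit complexity class DQC1)] [cite: KnillLaflamme1998, p. 5673 (DQC1)] -/
def IsDQC1Decidable (L : Language Bool) : Prop :=
  ∃ (k : List Bool → ℕ) (C : (x : List Bool) → QCircuit cliffordT (1 + k x)),
    (∀ x, (C x).IsOracleFree) ∧
    (fun x : List Bool => QCircuit.sigmaEncode (G := cliffordT) ⟨1, k x, C x⟩) ∈ FP ∧
    (∃ q : Polynomial ℕ, ∀ x : List Bool,
      (x ∈ L → (1 : ℝ) / 2 + 1 / (((q.eval x.length : ℕ) : ℝ) + 1) ≤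
        (∑ r : QReg (k x), ((1 : ℝ) / 2 ^ (k x)) *
          (C x).probEvent 0 (basisState (Fin.append (fun _ : Fin 1 => false) r))
            (QCircuit.acceptEvent (1 + k x)))) ∧
      (x ∉ L → (∑ r : QReg (k x), ((1 : ℝ) / 2 ^ (k x)) *
          (C x).probEvent 0 (basisState (Fin.append (fun _ : Fin 1 => false) r))
            (QCircuit.acceptEvent (1 + k x))) ≤ (1 : ℝ) / 2 - 1 / (((q.eval x.length : ℕ) : ℝ) + 1)))

/-- The class `DQC1` of languages decided in the one-clean-qubit model (Knill–Laflamme 1998;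
Shor–Jordan 2008 §1), as a set of languages. [cite: KnillLaflamme1998, p. 5673 (DQC1)] -/
def DQC1 : Set (Language Bool) := {L | IsDQC1Decidable L}

/-- **`DQC1 ⊆ BQP`** (Knill–Laflamme 1998, p. 5675: DQC1 has "power between classical computation
and deterministic quantum computation with pure states"; Shor–Jordan 2008 §1: one clean qubit
computers are "strictly weaker than standard quantum computers" — the folklore containment: feed
the register halves of Bell pairs (or uniformly random basis states), run the FP-described circuit
through a uniform family, measure the clean wire, amplify the `1/poly` bias by majority vote).
Verbatim the support item `Summit.QuantumAdvantage.QuantumAdvantage.Theses.SeparableFrames.OneCleanQubitInBQP`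
(stmt-QuantumAdvantage-9865, labelled "a theorem; XL to formalise").
[cite: KnillLaflamme1998, p. 5675 (DQC1 between classical and DQCp)] [cite: ShorJordan2008, §1] -/
def knillLaflamme1998_DQC1_subset_BQP : Prop :=
  ∀ L : Language Bool, IsDQC1Decidable L → L ∈ BQP

/-- Set form of the named fact. [folklore] -/
theorem DQC1_subset_BQP_of (h : knillLaflamme1998_DQC1_subset_BQP) : DQC1 ⊆ BQP :=
  fun L hL => h L hL

end Literature.Computability.QuantumComplexity

end
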